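import Summits.AtomisticToContinuum.BoseEinsteinCondensation.Theorems.BECGroundStateSOSPeriodicIRBoundTwoSectorLowDefs
import Summits.AtomisticToContinuum.BoseEinsteinCondensation.Theorems.BECGroundStateSOSPeriodicIRBoundTwoSectorFloatingFreeGas
import Summits.AtomisticToContinuum.BoseEinsteinCondensation.Theorems.PeriodicIRBound.Negative.AEClass
import HarnessLib

/-!
# Route `BECGroundStateSOS`, crux `PeriodicIRBound` (stmt-AtomisticToContinuum-3972), line `two-sector-gd-transfer`
# (v9) — stub S9' `stub_aeZeroFloatingLow : AeZeroFloatingLow` (the a.e.-free potentials carry the low-window load)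

Supports (does not close) stmt-AtomisticToContinuum-3972. The registered stub S9' of the v9 ("momentum-zero test
vectors, relaxed guard") skeleton of the line (statement `AeZeroFloatingLow` in
`Theorems/BECGroundStateSOSPeriodicIRBoundTwoSectorLowDefs.lean` §2): an admissible `v` with `∫ v(|x|)dx = 0` has, for
every window constant `K > 0`, data `ρ₀, C > 0`, `A ≥ 0` with `FloatingForLow v K ρ₀ C A`.

Proof. `∫ v(|x|)dx = 0` with `v` measurable says `v(|·|) = 0` a.e. on `ℝ³` (`lintegral_eq_zero_iff`), and the whole
problem sees `v` only through the a.e.-class of `x ↦ v(|x|)` (`Negative.AEClass`: `periodicInteraction_congr_ae`,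
`periodicEnergy_congr_ae`, `periodicGroundStateEnergy_congr_ae`): the unnormalised form `WF.qform`, the near-minimiser
predicate `NearMinAt` and hence the two channel inequalities `ChanPlus` / `ChanMinus` are transported verbatim
(§1, sub-namespace `AeZero`). On the FREE GAS both channel inequalities hold with `μ₊ = μ₋ = 0`, `E₀ ≡ 0`, bound
`b = CL²/‖n‖²_∞` for every `C ≥ 1/(4π²)` (landed `FloatingFreeGas.chanPlus_zero`, `FloatingFreeGas.chanMinus_zero`,
`FloatingFreeGas.one_le_bound_mul_eps`, p154826); restricting to momentum-zero near-minimisers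
(`chanPlusZero_of_chanPlus`, `chanMinusZero_of_chanMinus`) gives `FloatingForLow v K 1 (1/(4π²)) 0` for every `K` — the
momentum window, the density bound and the coupling slack `ε√(ρa)/L ≥ 0` are idle (§2). No open mathematics.
References (shape only; nothing is cited as a fact): T. Kennedy, E. H. Lieb, B. S. Shastry, J. Stat. Phys. 53 (1988)
1019, (12)–(14); F. J. Dyson, E. H. Lieb, B. Simon, J. Stat. Phys. 18 (1978) 335, §1.
-/

noncomputable section

open scoped BigOperators ENNReal ComplexConjugate
open Filter MeasureTheory

namespace Summit.AtomisticToContinuum.BoseEinsteinCondensation.Cruxes.PeriodicIRBound.TwoSectorGdTransfer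

open Literature.MathematicalPhysics.QuantumManyBody.BoseGas
open Summit.AtomisticToContinuum.BoseEinsteinCondensation.Cruxes.PeriodicIRBound.LinearPhFloorWagner (WF.qform)
open Summit.AtomisticToContinuum.BoseEinsteinCondensation.Theorems.PeriodicIRBound.Negative
  (periodicInteraction_congr_ae periodicEnergy_congr_ae periodicGroundStateEnergy_congr_ae)
open Summit.AtomisticToContinuum.BoseEinsteinCondensation.Theorems.GaussianDominationCan.Negative (one_le_norm_intVec)

namespace AeZero

/-! ## §1 Transport of the form, the near-minimiser predicate and the channels along the a.e.-class of `v ∘ |·|` -/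

/-- **The unnormalised form sees only the a.e.-class of `x ↦ v(|x|)`**: a.e.-equal radial profiles have IDENTICAL
forms `𝓔_v[f] = 𝓔_w[f]` on every `M`-body function (as `Negative.periodicEnergy_congr_ae`). [folklore] -/
theorem qform_congr_ae {v w : ℝ → ℝ≥0∞} (h : ∀ᵐ x : Space, v ‖x‖ = w ‖x‖) {M : ℕ} (L : ℝ) (f : Config M → ℂ) :
    WF.qform v L f = WF.qform w L f := by
  -- adapted from `Negative.periodicEnergy_congr_ae` (Theorems/PeriodicIRBound/Negative/AEClass.lean)
  unfold WF.qform
  refine lintegral_congr_ae (ae_restrict_of_ae ?_)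
  filter_upwards [periodicInteraction_congr_ae (N := M) h L] with X hX
  rw [hX]

/-- … identical near-minimiser predicates at fixed `(N, L)`. [folklore] -/
theorem nearMinAt_congr_ae {v w : ℝ → ℝ≥0∞} (h : ∀ᵐ x : Space, v ‖x‖ = w ‖x‖) {N : ℕ} {L : ℝ} (δ : ℝ≥0∞)
    (Ψ : PeriodicTrialState N L) : NearMinAt v δ Ψ ↔ NearMinAt w δ Ψ := by
  unfold NearMinAt
  rw [periodicEnergy_congr_ae h, periodicGroundStateEnergy_congr_ae h]

/-- … identical particle-channel inequalities (same threshold, same bound). [folklore] -/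
theorem chanPlus_congr_ae {v w : ℝ → ℝ≥0∞} (h : ∀ᵐ x : Space, v ‖x‖ = w ‖x‖) (m : ℕ) (L : ℝ) (n : Fin 3 → ℤ)
    (T b : ℝ) : ChanPlus v m L n T b ↔ ChanPlus w m L n T b := by
  unfold ChanPlus
  simp only [nearMinAt_congr_ae h, qform_congr_ae h]

/-- … identical hole-channel inequalities (same threshold, same bound). [folklore] -/
theorem chanMinus_congr_ae {v w : ℝ → ℝ≥0∞} (h : ∀ᵐ x : Space, v ‖x‖ = w ‖x‖) (m : ℕ) (L : ℝ) (n : Fin 3 → ℤ)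
    (T b : ℝ) : ChanMinus v m L n T b ↔ ChanMinus w m L n T b := by
  unfold ChanMinus
  simp only [nearMinAt_congr_ae h, qform_congr_ae h]

/-- `∫ v(|x|)dx = 0` with `v` measurable: `v(|·|)` vanishes a.e. on `ℝ³`, i.e. `v ∘ |·|` is in the a.e.-class of the
free gas `0 ∘ |·|`. [folklore] -/
theorem radial_ae_eq_zero_of_lintegral_eq_zero {v : ℝ → ℝ≥0∞} (hv : Measurable v) (h0 : (∫⁻ x : Space, v ‖x‖) = 0) :
    ∀ᵐ x : Space, v ‖x‖ = (0 : ℝ → ℝ≥0∞) ‖x‖ := by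
  have h := (lintegral_eq_zero_iff (hv.comp measurable_norm)).1 h0
  filter_upwards [h] with x hx
  simpa using hx

/-! ## §2 The free-gas channels, transported -/

/-- **`FloatingForLow v K 1 C 0` for an a.e.-free admissible `v`**, every `K` and every `C ≥ 1/(4π²)`: at every
`N = m + 2` and every mode `n ≠ 0` take `μ₊ = μ₋ = 0`; `E₀(v) = E₀(0) = 0` and the free-gas channel inequalities
(`FloatingFreeGas.chanPlus_zero` with `bε_n ≥ 1`, `FloatingFreeGas.chanMinus_zero`) transport to `v`. [folklore] -/
theorem floatingForLow_of_ae_zero {v : ℝ → ℝ≥0∞} (hae : ∀ᵐ x : Space, v ‖x‖ = (0 : ℝ → ℝ≥0∞) ‖x‖) (K : ℝ) {C : ℝ}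
    (hC : 1 / (4 * Real.pi ^ 2) ≤ C) : FloatingForLow v K 1 C 0 := by
  -- adapted from `FloatingFreeGas.floatingFor_zero`
  -- (Theorems/BECGroundStateSOSPeriodicIRBoundTwoSectorFloatingFreeGas.lean)
  intro ε hε ρ hρ _
  refine Filter.Eventually.of_forall fun m n hn _ => ?_
  have hL : 0 < sideLength ρ (m + 2) := sideLength_pos_of_pos hρ (by omega)
  have hn1 : 1 ≤ ‖(fun j => (n j : ℝ))‖ := one_le_norm_intVec hn
  have hb : 0 < C * sideLength ρ (m + 2) ^ 2 / ‖(fun j => (n j : ℝ))‖ ^ 2 := by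
    have hCpos : 0 < C := lt_of_lt_of_le (by positivity) hC
    positivity
  have hE0 : periodicGroundStateEnergy v (m + 2) (sideLength ρ (m + 2)) = 0 := by
    rw [periodicGroundStateEnergy_congr_ae hae (m + 2) (sideLength ρ (m + 2))]
    exact periodicGroundStateEnergy_zero_eq_zero (m + 2) hL
  refine ⟨0, 0, ?_, ?_, ?_, ?_⟩
  · rw [zero_mul, neg_zero]
  · rw [zero_add]
    exact div_nonneg (mul_nonneg hε.le (Real.sqrt_nonneg _)) hL.le
  · rw [hE0, ENNReal.toReal_zero, add_zero]
    exact chanPlusZero_of_chanPlus ((chanPlus_congr_ae hae m _ n _ _).2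
      (FloatingFreeGas.chanPlus_zero m hL n hb le_rfl (FloatingFreeGas.one_le_bound_mul_eps hL hn hC)))
  · rw [hE0, ENNReal.toReal_zero, sub_zero]
    exact chanMinusZero_of_chanMinus ((chanMinus_congr_ae hae m _ n _ _).2
      (FloatingFreeGas.chanMinus_zero m hL hn hb))

end AeZero

/-- **Registered stub S9' `stub_aeZeroFloatingLow` of the crux ledger** (line `two-sector-gd-transfer`, v9): an
admissible `v` with `∫ v(|x|)dx = 0` carries the low-window floating two-channel bound — for every `K > 0`,
`FloatingForLow v K 1 (1/(4π²)) 0` (`AeZero.floatingForLow_of_ae_zero`: the free-gas channels of p154826 transported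
along the a.e.-class of `v ∘ |·|`, `μ₊ = μ₋ = 0`). [folklore] -/
theorem stub_aeZeroFloatingLow : AeZeroFloatingLow := by
  intro v hv h0 K _
  exact ⟨1, one_pos, 1 / (4 * Real.pi ^ 2), by positivity, 0, le_rfl,
    AeZero.floatingForLow_of_ae_zero (AeZero.radial_ae_eq_zero_of_lintegral_eq_zero hv.1 h0) K le_rfl⟩

end Summit.AtomisticToContinuum.BoseEinsteinCondensation.Cruxes.PeriodicIRBound.TwoSectorGdTransfer

end
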